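import Mathlib
import Summits.KontsevichZagierPeriods.KontsevichZagierPeriods.Theorems.SoloInformedSumFormula
import Summits.KontsevichZagierPeriods.KontsevichZagierPeriods.Theorems.SoloInformedStuffle
import Summits.KontsevichZagierPeriods.KontsevichZagierPeriods.Theorems.SoloInformedDualityAll
import Literature.NumberTheory.Transcendental.MultipleZetaWeightFiveProofs
import HarnessLib
import HarnessLib.Audit

/-!
# SoloInformed — THEOREM XLIV: the weight-5 table of the formal period ring

Solo programme `solo-KontsevichZagierPeriods-informed`, session s47 (PROGRAMME XLIV). In
`𝒫 = KZ.FormalPeriodRing` (relations = Kontsevich–Zagier's three rules only) the eight multiple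
zeta classes of weight `5` — `Z(5), Z(4,1), Z(3,2), Z(2,3), Z(3,1,1), Z(2,2,1), Z(2,1,2),
Z(2,1,1,1)` — satisfy, with INTEGER coefficients,

  `6·Z(s) ∈ ℤ·Z(5) + ℤ·Z(3,2)`   for every admissible `s` of weight `5`

(`soloInformed_mzvClass_weight5_table`, explicit coefficients in `soloInformed_weight5_…`):
the formal (motivic-style) version of `d₅ ≤ 2`, obtained by NAIVE MOVES ALONE from
* the sum formula `Z(2,3) + Z(3,2) + Z(4,1) = Z(5)` (THEOREM XXXIX, `soloInformed_mzvClass_sumFormula_m 1`),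
* the double shuffle `6Z(4,1) + 2Z(3,2) = Z(5)` (THEOREMS XL + XLI, `soloInformed_mzvClass_weight5_ds`),
* duality `Z(2,1,1,1) = Z(5)`, `Z(3,1,1) = Z(4,1)`, `Z(2,2,1) = Z(3,2)`, `Z(2,1,2) = Z(2,3)`
  (THEOREM XLIII, `soloInformed_mzvClass_dual_weight5`),
together with the enumeration of the admissible indices of weight `5`
(the enumeration `MZV.eq_of_isAdmissible_of_weight_eq_five` of the Literature). Applying `evalP` gives the classical real relations; the content is
that they hold between the abstract periods, so that `𝒫₅^{MZV} ⊗ ℚ` is spanned by `Z(5), Z(3,2)`.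

References: Zagier 1994 §9 (d₅ = 2 conjecturally); Hoffman 1992 §3; Kontsevich–Zagier 2001 §1.2.
-/

noncomputable section

open Literature.NumberTheory.Transcendental
open Literature.NumberTheory.Transcendental.KZ

namespace Summit.KontsevichZagierPeriods.KontsevichZagierPeriods.Theorems

/-! ## 1. The depth-≤-2 relations at weight 5 -/

/-- The sum formula at weight 5: `Z(2,3) + Z(3,2) + Z(4,1) = Z(5)` in `𝒫`. -/
theorem soloInformed_weight5_sum :
    mzvClass [2, 3] + mzvClass [3, 2] + mzvClass [4, 1] = mzvClass [5] := by
  have h := soloInformed_mzvClass_sumFormula_m 1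
  simp only [Finset.sum_range_succ, Finset.sum_range_zero, zero_add] at h
  exact h

/-- `6·Z(4,1) = Z(5) − 2·Z(3,2)`. -/
theorem soloInformed_weight5_Z41 :
    6 • mzvClass [4, 1] = mzvClass [5] - 2 • mzvClass [3, 2] := by
  rw [← soloInformed_mzvClass_weight5_ds]
  abel

/-- `6·Z(2,3) = 5·Z(5) − 4·Z(3,2)`. -/
theorem soloInformed_weight5_Z23 :
    6 • mzvClass [2, 3] = 5 • mzvClass [5] - 4 • mzvClass [3, 2] := by
  have h1 := soloInformed_weight5_sum
  have h2 := soloInformed_mzvClass_weight5_ds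
  have h3 : 6 • mzvClass [2, 3] = 6 • mzvClass [5] - 6 • mzvClass [3, 2] - 6 • mzvClass [4, 1] := by
    rw [← h1]
    abel
  rw [h3, ← h2]
  abel

/-! ## 2. Depth ≥ 3 by duality -/

/-- `6·Z(3,1,1) = Z(5) − 2·Z(3,2)`. -/
theorem soloInformed_weight5_Z311 :
    6 • mzvClass [3, 1, 1] = mzvClass [5] - 2 • mzvClass [3, 2] := by
  rw [soloInformed_mzvClass_dual_weight5.2.1, soloInformed_weight5_Z41]

/-- `Z(2,2,1) = Z(3,2)`. -/
theorem soloInformed_weight5_Z221 : mzvClass [2, 2, 1] = mzvClass [3, 2] :=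
  soloInformed_mzvClass_dual_weight5.2.2.1

/-- `6·Z(2,1,2) = 5·Z(5) − 4·Z(3,2)`. -/
theorem soloInformed_weight5_Z212 :
    6 • mzvClass [2, 1, 2] = 5 • mzvClass [5] - 4 • mzvClass [3, 2] := by
  rw [soloInformed_mzvClass_dual_weight5.2.2.2, soloInformed_weight5_Z23]

/-- `Z(2,1,1,1) = Z(5)`. -/
theorem soloInformed_weight5_Z2111 : mzvClass [2, 1, 1, 1] = mzvClass [5] :=
  soloInformed_mzvClass_dual_weight5.1

/-! ## 3. The table (the eight admissible indices are enumerated in the Literature) -/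

/-- **THEOREM XLIV (the weight-5 table of `𝒫`).** For every admissible index `s` of weight `5`
there are integers `a, b` with `6 · mzvClass s = a · Z(5) + b · Z(3,2)` in the formal period ring —
from the sum formula, the double shuffle and duality, i.e. from the three Kontsevich–Zagier rules.
[Zagier 1994 §9; Hoffman 1992 §3; KZ 2001 §1.2] -/
theorem soloInformed_mzvClass_weight5_table {s : List ℕ} (hs : MZV.IsAdmissible s)
    (hw : MZV.weight s = 5) :
    ∃ a b : ℤ, 6 • mzvClass s = a • mzvClass [5] + b • mzvClass [3, 2] := by
  rcases MZV.eq_of_isAdmissible_of_weight_eq_five hs hw with rfl | rfl | rfl | rfl | rfl | rfl | rfl | rfl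
  · exact ⟨6, 0, by simp⟩
  · exact ⟨1, -2, by rw [soloInformed_weight5_Z41]; simp [sub_eq_add_neg]⟩
  · exact ⟨0, 6, by simp⟩
  · exact ⟨5, -4, by rw [soloInformed_weight5_Z23]; simp [sub_eq_add_neg]⟩
  · exact ⟨1, -2, by rw [soloInformed_weight5_Z311]; simp [sub_eq_add_neg]⟩
  · exact ⟨0, 6, by rw [soloInformed_weight5_Z221]; simp⟩
  · exact ⟨5, -4, by rw [soloInformed_weight5_Z212]; simp [sub_eq_add_neg]⟩
  · exact ⟨6, 0, by rw [soloInformed_weight5_Z2111]; simp⟩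

/-- **COROLLARY (`dim 𝒫₅^{MZV} ⊗ ℚ ≤ 2`, integral form).** Six times every weight-5 multiple zeta
class lies in the `ℤ`-span of `Z(5)` and `Z(3,2)`. -/
theorem soloInformed_mzvClass_weight5_mem_span {s : List ℕ} (hs : MZV.IsAdmissible s)
    (hw : MZV.weight s = 5) :
    6 • mzvClass s ∈ Submodule.span ℤ ({mzvClass [5], mzvClass [3, 2]} : Set FormalPeriodRing) := by
  obtain ⟨a, b, h⟩ := soloInformed_mzvClass_weight5_table hs hw
  rw [h]
  exact Submodule.add_mem _
    (Submodule.smul_mem _ a (Submodule.subset_span (by simp)))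
    (Submodule.smul_mem _ b (Submodule.subset_span (by simp)))

/-- The numerical shadow under `evalP`: every real multiple zeta value of weight `5` is a
`ℚ`-combination of `ζ(5)` and `ζ(3,2)` (classical; here a corollary of the formal table). -/
theorem soloInformed_multipleZeta_weight5 {s : List ℕ} (hs : MZV.IsAdmissible s)
    (hw : MZV.weight s = 5) :
    ∃ a b : ℚ, multipleZeta s = a * multipleZeta [5] + b * multipleZeta [3, 2] := by
  obtain ⟨a, b, h⟩ := soloInformed_mzvClass_weight5_table hs hw
  have h' := congrArg evalP h
  rw [map_nsmul, map_add, map_zsmul, map_zsmul, evalP_mzvClass hs,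
    evalP_mzvClass (by decide), evalP_mzvClass (by decide)] at h'
  refine ⟨a / 6, b / 6, ?_⟩
  have h6 : (6 : ℝ) ≠ 0 := by norm_num
  field_simp
  rw [nsmul_eq_mul, zsmul_eq_mul, zsmul_eq_mul] at h'
  push_cast at h' ⊢
  linarith

end Summit.KontsevichZagierPeriods.KontsevichZagierPeriods.Theorems
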